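import Summits.Langlands.Langlands.Theses.HeptagonalTower

/-!
# Crux `TorsionSeven` (stmt-Langlands-16989, route-Langlands-HeptagonalTower, rank 5) — birth skeleton (BC3)

Line `birth`: torsion rigidity of `X₀(15)` — the Legendre model `E : y² = x³ + 41x² + 400x`
(`⟨0, 41, 0, 400, 0⟩ : WeierstrassCurve ℚ` — the route file's structure literal, same term) — along the real
`7`-cyclotomic tower, cut BY MECHANISM into three stubs whose composition is pure logic:

* `stub_torsion_two_primary` (odd part; the load-bearing stub): for `K` totally real inside some
  `ℚ(ζ_{7^{n+1}})`, every torsion `K`-point of `E` has `2`-power order, i.e. `E(K)[ℓ] = 0` for every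
  odd prime `ℓ`. Printed pattern: `ρ̄_{E,ℓ}(G_ℚ) = GL₂(𝔽_ℓ)` for `ℓ ≥ 3` (vendored named fact
  `Literature.NumberTheory.Automorphic.Thorne2019_surjective_modEll_E₁` on the minimal model `E₁`,
  bridged by the proved `Thorne2019.variableChange_E₁`; second source
  `Literature.NumberTheory.EllipticCurves.Edixhoven1997_prop_2_1` + `#E(𝔽₇) = 8`, `#E(𝔽₁₁) = 16`);
  `ρ̄_ℓ(G_K) ⊴ GL₂(𝔽_ℓ)` has odd index dividing `[K:ℚ] ∣ 3·7ⁿ`, so it contains every involution, in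
  particular `−1`, which fixes no non-zero vector of `E[ℓ]` — so no `K`-rational point of order `ℓ`.
  Why it might fail: only through the image input (if `ρ̄_{E,ℓ}` were not surjective at some odd `ℓ`
  the parity argument must be redone with the true image). Size: L (Galois action on `E[ℓ](K̄)` vs.
  `K`-rational torsion is thin API in the tree: `WeierstrassCurve.HasSurjectiveModNGaloisRep`).
* `stub_two_primary_torsion_descends` (even part): for the same `K`, every `K`-point of `2`-power
  order comes from a rational torsion point (`E(K)[2^∞] = E(ℚ)[2^∞]`). Elementary: `E[2] ⊂ E(ℚ)`
  (`x = 0, −16, −25`), so halving a rational point only adjoins square roots (the halving quartic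
  `(x² − 400)² = 4·x(Q)·x(x+16)(x+25)` has Galois group a `2`-group), and a `2`-power-degree
  subextension of the odd-degree field `K` is `ℚ`; induct on the order. Equivalently: the `2`-adic
  image lies in `ker(GL₂(ℤ₂) → GL₂(𝔽₂))`, a pro-`2` group, whose normal subgroup `ρ(G_K)` of odd index
  is everything. Why it might fail: it should not (unconditional); the formal cost is the halving
  computation / `minpoly`-degree bookkeeping. Size: M.
* `stub_rational_torsion_eight` (base of the tower): `E(ℚ)_tors ⊆ {O, (0,0), (−16,0), (−25,0),
  (20,±180), (−20,±20)}` (`≅ ℤ/2 × ℤ/4`). Printed: Cremona 15A1 / Thorne 2019 Prop. 4 (vendored named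
  fact `Literature.NumberTheory.Automorphic.Thorne2019_prop4` on `E₁` + the proved Legendre bridge;
  the grounder checked the eight points map exactly onto this list); in-kernel alternatives:
  reduction mod `7` and `11` (`#E(𝔽₇) = 8`, `#E(𝔽₁₁) = 16`) or Lutz–Nagell — neither in Mathlib.
  Why it might fail: it cannot (classical table), but the torsion-injects-under-reduction lemma is
  unbuilt. Size: M.
* Composition: `TorsionSeven_of_stubs` (private) : stubA → stubB → stubC → `TorsionSeven`,
  kernel-checked, no `sorry` — take a torsion `K`-point, stub A makes its order a power of `2`, stub B
  descends it to a rational torsion point `(x₀, y₀)`, stub C lists `(x₀, y₀)`, and `algebraMap ℚ K`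
  transports the eight coordinate pairs (`map_ofNat`/`map_neg` + `CharZero K`); and the registered
  skeleton theorem `TorsionSeven_of : TorsionSeven` = that implication applied to the three named
  stubs (zero hypotheses, concludes the crux by name; `sorryAx` only via the stubs).

Hardest stub: `stub_torsion_two_primary` (the only one with a named-fact input; the crux's own
why-might-fail). Disproof used: none exists for this crux (`ledger crux ls stmt-Langlands-16989`: no
`Disproof.lean`, 2026-08-17). Negatives index / dead lines: none touch torsion of `X₀(15)`.
Barriers: none of `Literature.Barriers.Langlands.*` concerns torsion growth of a fixed curve over ℚ
in an abelian tower (no lifting, no patching, no local Langlands is used).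
Grounder notes honoured: g74-1 (Thorne 2019 Thm 5 / Prop 4 vendored; image fact p135513) and g74-3
(the `−1 ∈ ρ̄(G_K)` one-liner for odd `ℓ`; `E[2] ⊂ E(ℚ)` ⇒ pro-`2` for `ℓ = 2`) — stubs A/B are cut
exactly along those two arguments.
-/

namespace Summit.Langlands.Langlands.Cruxes.TorsionSeven.Birth

open Summit.Langlands.Langlands.Theses.HeptagonalTower
open scoped Classical

/-- **Stub A (odd part, load-bearing).** Over every totally real `K ⊂ ℚ(ζ_{7^{n+1}})`, every torsion
`K`-point of the Legendre model of `X₀(15)` has `2`-power order (no `K`-rational `ℓ`-torsion for odd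
primes `ℓ`: big mod-`ℓ` image + odd index ⇒ `−1 ∈ ρ̄_ℓ(G_K)`). -/
theorem stub_torsion_two_primary :
    ∀ (K : Type) [Field K] [NumberField K], NumberField.IsTotallyReal K →
      (∃ n : ℕ, Nonempty (K →+* CyclotomicField ((7 : ℕ+) ^ (n + 1)) ℚ)) →
      ∀ P : ((⟨0, 41, 0, 400, 0⟩ : WeierstrassCurve ℚ).baseChange
          K).toAffine.Point,
        IsOfFinAddOrder P → ∃ k : ℕ, addOrderOf P = 2 ^ k := by
  sorry

/-- **Stub B (even part).** Over every totally real `K ⊂ ℚ(ζ_{7^{n+1}})`, every `K`-point of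
`2`-power order of the Legendre model of `X₀(15)` is the image of a rational torsion point
(`E(K)[2^∞] = E(ℚ)[2^∞]`: `E[2] ⊂ E(ℚ)`, halving adjoins only square roots, `[K:ℚ]` is odd). -/
theorem stub_two_primary_torsion_descends :
    ∀ (K : Type) [Field K] [NumberField K], NumberField.IsTotallyReal K →
      (∃ n : ℕ, Nonempty (K →+* CyclotomicField ((7 : ℕ+) ^ (n + 1)) ℚ)) →
      ∀ (x y : K) (h : ((⟨0, 41, 0, 400, 0⟩ : WeierstrassCurve
          ℚ).baseChange K).toAffine.Nonsingular x y),
        (∃ k : ℕ, addOrderOf (WeierstrassCurve.Affine.Point.some x y h) = 2 ^ k) →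
        ∃ (x₀ y₀ : ℚ) (h₀ : (⟨0, 41, 0, 400, 0⟩ :
            WeierstrassCurve ℚ).toAffine.Nonsingular x₀ y₀),
          IsOfFinAddOrder (WeierstrassCurve.Affine.Point.some x₀ y₀ h₀) ∧
            x = algebraMap ℚ K x₀ ∧ y = algebraMap ℚ K y₀ := by
  sorry

/-- **Stub C (base of the tower).** Every rational torsion point of the Legendre model of `X₀(15)`
is one of the eight listed points (`X₀(15)(ℚ) ≅ ℤ/2 × ℤ/4`; Cremona 15A1, Thorne 2019 Prop. 4 via the
proved Legendre bridge; in-kernel: reduction mod `7` and `11`). -/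
theorem stub_rational_torsion_eight :
    ∀ (x y : ℚ) (h : (⟨0, 41, 0, 400, 0⟩ :
        WeierstrassCurve ℚ).toAffine.Nonsingular x y),
      IsOfFinAddOrder (WeierstrassCurve.Affine.Point.some x y h) →
      (x = 0 ∧ y = 0) ∨ (x = -16 ∧ y = 0) ∨ (x = -25 ∧ y = 0) ∨ (x = 20 ∧ y = 180) ∨
        (x = 20 ∧ y = -180) ∨ (x = -20 ∧ y = 20) ∨ (x = -20 ∧ y = -20) := by
  sorry

/-- **Composition, implication form (kernel-checked, no `sorry`, closure ⊆ {propext,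
Classical.choice, Quot.sound}).** Stub A → Stub B → Stub C → the crux `TorsionSeven` (by name).
`private` only so that the skeleton audit sees exactly one public theorem concluding the crux. -/
private theorem TorsionSeven_of_stubs :
    (∀ (K : Type) [Field K] [NumberField K], NumberField.IsTotallyReal K →
      (∃ n : ℕ, Nonempty (K →+* CyclotomicField ((7 : ℕ+) ^ (n + 1)) ℚ)) →
      ∀ P : ((⟨0, 41, 0, 400, 0⟩ : WeierstrassCurve ℚ).baseChange
          K).toAffine.Point,
        IsOfFinAddOrder P → ∃ k : ℕ, addOrderOf P = 2 ^ k) →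
    (∀ (K : Type) [Field K] [NumberField K], NumberField.IsTotallyReal K →
      (∃ n : ℕ, Nonempty (K →+* CyclotomicField ((7 : ℕ+) ^ (n + 1)) ℚ)) →
      ∀ (x y : K) (h : ((⟨0, 41, 0, 400, 0⟩ : WeierstrassCurve
          ℚ).baseChange K).toAffine.Nonsingular x y),
        (∃ k : ℕ, addOrderOf (WeierstrassCurve.Affine.Point.some x y h) = 2 ^ k) →
        ∃ (x₀ y₀ : ℚ) (h₀ : (⟨0, 41, 0, 400, 0⟩ :
            WeierstrassCurve ℚ).toAffine.Nonsingular x₀ y₀),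
          IsOfFinAddOrder (WeierstrassCurve.Affine.Point.some x₀ y₀ h₀) ∧
            x = algebraMap ℚ K x₀ ∧ y = algebraMap ℚ K y₀) →
    (∀ (x y : ℚ) (h : (⟨0, 41, 0, 400, 0⟩ :
        WeierstrassCurve ℚ).toAffine.Nonsingular x y),
      IsOfFinAddOrder (WeierstrassCurve.Affine.Point.some x y h) →
      (x = 0 ∧ y = 0) ∨ (x = -16 ∧ y = 0) ∨ (x = -25 ∧ y = 0) ∨ (x = 20 ∧ y = 180) ∨
        (x = 20 ∧ y = -180) ∨ (x = -20 ∧ y = 20) ∨ (x = -20 ∧ y = -20)) →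
    TorsionSeven := by
  intro hA hB hC K _ _ hK hemb x y h hfin
  obtain ⟨x₀, y₀, h₀, hfin₀, rfl, rfl⟩ := hB K hK hemb x y h (hA K hK hemb _ hfin)
  rcases hC x₀ y₀ h₀ hfin₀ with ⟨rfl, rfl⟩ | ⟨rfl, rfl⟩ | ⟨rfl, rfl⟩ | ⟨rfl, rfl⟩ | ⟨rfl, rfl⟩ |
    ⟨rfl, rfl⟩ | ⟨rfl, rfl⟩ <;> norm_num

/-- **The skeleton theorem (registered shape): the crux `TorsionSeven` BY NAME from the three named
stubs.** Its closure carries `sorryAx` exactly through `stub_torsion_two_primary`,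
`stub_two_primary_torsion_descends`, `stub_rational_torsion_eight`; when the three stubs are proved
(`propose --supports stmt-Langlands-16989`, by name + signature) this is the crux proof. -/
theorem TorsionSeven_of : TorsionSeven :=
  TorsionSeven_of_stubs stub_torsion_two_primary stub_two_primary_torsion_descends
    stub_rational_torsion_eight

end Summit.Langlands.Langlands.Cruxes.TorsionSeven.Birth
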